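import Mathlib
import Summits.ValiantsHypothesis.ValiantsHypothesis.Theses.BinomialElusive
import Summits.ValiantsHypothesis.ValiantsHypothesis.Theorems.BinomialElusiveNumericToPuiseux
import Summits.ValiantsHypothesis.ValiantsHypothesis.Theorems.BinomialElusiveNoShortRelations

/-!
# Route `BinomialElusive` — instantiation glue for the cruxes `BinomialCandidate` (X) and
# `BinomialMapsElusive` (X restricted to binomial maps)

The route's foreseen `k = 3` glue (route text, TWO-LAYER PLAN): the symbolic crux `PeelingLemma`
together with the two PROVED supports `NumericToPuiseux` (`numericToPuiseux_proof`) and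
`NoShortRelations` (`noShortRelations_proof`) gives the thesis `BinomialCandidate` by instantiation,
and `BinomialCandidate` gives `BinomialMapsElusive` by restriction (the binomial-map hypothesis
`(Γ i).support.card ≤ 2` is simply dropped).

* `binomialMapsElusive_of_binomialCandidate : BinomialCandidate → BinomialMapsElusive`;
* `binomialCandidate_of_peelingLemma : PeelingLemma → BinomialCandidate`: a containment of the
  E-curve in `Γ(ℂ^{m-1})` gives (NumericToPuiseux) `N ≥ 1` and Laurent `p` with
  `Γ_i(p) = t^{N E(2i+1)} + t^{N E(2i+2)}`; PeelingLemma gives a nonzero `(u, v)` with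
  `Σ (|u_i| + |v_i|) ≤ ⌊log₂ m⌋²` and `Σ (u_i E(2i+1) + v_i E(2i+2)) = 0`; interleaving
  `w(2i) = u_i`, `w(2i+1) = v_i` turns this into a relation of length `≤ h` among
  the `E(j+1)`, `j < 2m`, which NoShortRelations (with `h = ⌊log₂ m⌋²`) forces to be zero;
* `binomialMapsElusive_of_peelingLemma`: the composite.

No new mathematics: bookkeeping over Mathlib's `finProdFinEquiv` (interleaving `Fin m × Fin 2 ≃
Fin (2m)`).
-/

-- layout Summits/ValiantsHypothesis/ValiantsHypothesis forces the duplicated namespace component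
set_option linter.dupNamespace false

namespace Summit.ValiantsHypothesis.ValiantsHypothesis.Theorems.BinomialMapsElusiveGlue

open scoped BigOperators
open Finset
open Summit.ValiantsHypothesis.ValiantsHypothesis.Theses.BinomialElusive

/-- `BinomialCandidate → BinomialMapsElusive`: X restricted to binomial maps follows from X by
dropping the hypothesis `(Γ i).support.card ≤ 2`. -/
theorem binomialMapsElusive_of_binomialCandidate (hX : BinomialCandidate) : BinomialMapsElusive := by
  obtain ⟨m₀, hm₀⟩ := hX
  exact ⟨m₀, fun m hm Γ hdeg _ => hm₀ m hm Γ hdeg⟩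

/-- Sums over `Fin (2m)` split along the interleaving `(i, c) ↦ 2i + c` (`Fin m × Fin 2 ≃ Fin (2m)`,
Mathlib's `finProdFinEquiv` followed by the cast `m * 2 = 2 * m`) into even and odd positions. -/
theorem sum_interleaved {m : ℕ} {M : Type*} [AddCommMonoid M] (f : Fin (2 * m) → M) :
    ∑ j, f j = ∑ i : Fin m,
      (f ((finProdFinEquiv.trans (finCongr (Nat.mul_comm m 2))) (i, 0)) +
        f ((finProdFinEquiv.trans (finCongr (Nat.mul_comm m 2))) (i, 1))) := by
  rw [← Equiv.sum_comp (finProdFinEquiv.trans (finCongr (Nat.mul_comm m 2))), Fintype.sum_prod_type]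
  simp [Fin.sum_univ_two]

/-- `PeelingLemma → BinomialCandidate`: instantiation with `numericToPuiseux_proof` and
`noShortRelations_proof` (the route's `k = 3` glue). -/
theorem binomialCandidate_of_peelingLemma (hP : PeelingLemma) : BinomialCandidate := by
  obtain ⟨m₀, hm₀⟩ := hP
  refine ⟨m₀, fun m hm Γ hdeg hsub => ?_⟩
  -- the exponent data of the E-curve
  set h : ℕ := Nat.log 2 m ^ 2 with hh
  set E : ℕ → ℕ := fun j => ∑ k ∈ Finset.range (h + 1), (j * (2 * m + 2) ^ (h + 1)) ^ k with hE
  set a : Fin m → ℕ := fun i => E (2 * (i : ℕ) + 1) with ha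
  set b : Fin m → ℕ := fun i => E (2 * (i : ℕ) + 2) with hb
  -- `m = 0` is excluded by PeelingLemma itself: it would yield `(u, v) ≠ 0` with `u v : Fin 0 → ℤ`
  have hm0 : 0 < m := by
    by_contra h0
    have : m = 0 := by omega
    subst this
    obtain ⟨u, v, huv, -, -⟩ := hm₀ 0 hm (fun _ => 0) (fun _ => 0) Γ 1 (fun _ => 0) hdeg
      Nat.one_pos (fun i => Fin.elim0 i)
    exact huv (Prod.ext (funext fun i => Fin.elim0 i) (funext fun i => Fin.elim0 i))
  obtain ⟨N, p, hN, hp⟩ := Summit.ValiantsHypothesis.Theorems.numericToPuiseux_proof m (m - 1)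
    a b Γ hm0 hsub
  obtain ⟨u, v, huv, hlen, hrel⟩ := hm₀ m hm a b Γ N p hdeg hN hp
  -- interleave (`w(2i) = u_i`, `w(2i+1) = v_i`) and apply NoShortRelations with `h = ⌊log₂ m⌋²`
  set e : Fin m × Fin 2 ≃ Fin (2 * m) := finProdFinEquiv.trans (finCongr (Nat.mul_comm m 2)) with he
  have he_val : ∀ (i : Fin m) (c : Fin 2), ((e (i, c) : Fin (2 * m)) : ℕ) = (c : ℕ) + 2 * (i : ℕ) :=
    fun _ _ => rfl
  set w : Fin (2 * m) → ℤ := fun j => if (e.symm j).2 = 0 then u (e.symm j).1 else v (e.symm j).1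
    with hw_def
  have hw0 : ∀ i, w (e (i, 0)) = u i := fun i => by simp [hw_def]
  have hw1 : ∀ i, w (e (i, 1)) = v i := fun i => by simp [hw_def]
  have hw : w = 0 := by
    refine Summit.ValiantsHypothesis.ValiantsHypothesis.Theorems.BinomialElusiveNoShortRelations.noShortRelations_proof
      m h w ?_ ?_
    · rw [sum_interleaved]
      simp only [← he, hw0, hw1]
      exact_mod_cast hlen
    · rw [sum_interleaved]
      simp only [← he, hw0, hw1]
      rw [← hrel]
      refine Finset.sum_congr rfl fun i _ => ?_
      rw [he_val i 0, he_val i 1, Fin.val_zero, Fin.val_one, zero_add, ha, hb, hE]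
      push_cast
      ring_nf
  have hu : u = 0 := funext fun i => by rw [← hw0 i, hw]; rfl
  have hv : v = 0 := funext fun i => by rw [← hw1 i, hw]; rfl
  exact huv (by rw [hu, hv]; rfl)

/-- `PeelingLemma → BinomialMapsElusive` (composite of the two glue steps). -/
theorem binomialMapsElusive_of_peelingLemma (hP : PeelingLemma) : BinomialMapsElusive :=
  binomialMapsElusive_of_binomialCandidate (binomialCandidate_of_peelingLemma hP)

end Summit.ValiantsHypothesis.ValiantsHypothesis.Theorems.BinomialMapsElusiveGlue
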